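import Mathlib
import HarnessLib
import HarnessLib.Audit
import Summits.PneNP.PneNP.Theses.Autoreducibility
import Literature.Computability.Complexity.Autoreducibility
import Literature.Computability.Complexity.LengthCompare
import Literature.Barriers.PneNP.RelativizedCircuitSizeThm4Scope

/-!
# Line `birth` — BC3 skeleton for the crux `TallyAutoreducible` (stmt-PneNP-15947)

Route `Autoreducibility` (route-PneNP-Autoreducibility), crux (rank 3) `TallyAutoreducible`: every
`A ∈ EXP` that is `≤ᵖ_{3-tt}`-hard for `EXP` (every `K ∈ EXP` is `ttLang Q (C 3) D A`, `Q ∈ FP`, `D ∈ P` —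
definitionally `IsBddTTHard 3 EXP A`) has a polynomial-time SELF-AVOIDING nonadaptive query scheme
(`Q ∈ FP`, `q`, `D ∈ P`, `Q⟨x,1ⁱ⟩ ≠ x` for `i < q(|x|)`) that decides membership correctly ON EVERY TALLY
INPUT `0ⁿ`. The route's deciding theorem `closes : TallyAutoreducible → TallyDiagonalBridge → PneNP` is
landed, so the crux is SUMMIT-STRENGTH by design ("the weakest sufficient form"; route header: "under
P = NP it is false by the bridge, so it is at least as hard to prove as P ≠ NP is true"). Consequently EVERY
cut of it into a KNOWN structural piece and a residue leaves a summit-strength residue; the job of this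
skeleton is to make the residue as small and as concretely-hypothesised as the literature allows, and to
bank the known piece as a provable stub.

THE LINE = ROUNDS (the 2001 archive's Corollary "sandwich" (c): for `≤tt`-complete sets of `EXP`,
"2-round-tt-autoreducible ⇒ 1-round" IS question 4 of Buhrman–Fortnow–van Melkebeek–Torenvliet, because two
rounds ALWAYS suffice — archive Theorem B = BFvMT Thm 4.1 with the rounds book-kept, refereed ×7 with a Lean
leg in the 2001 programme). Restricted to tallies and weakened to all-but-finitely-many lengths:

* `stub_twoRound` — TWO ROUNDS ALWAYS SUFFICE (archive thm:B, typed over the tree's `ttLang`): every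
  `≤ᵖ_{3-tt}`-hard `A ∈ EXP` equals `ttLang Q₁ q₁ (ttLang Q₂ q₂ D₂ A) A` — round 1 asks `Q₁⟨x,1ⁱ⟩ ≠ x`,
  its "evaluator" is itself the tt-reduction `ttLang Q₂ q₂ D₂ A` run on `⟨x, round-1 answers⟩`, whose
  queries `Q₂⟨⟨x,a⟩,1ⁱ⟩ ≠ x` form round 2. KNOWN (BFvMT 2000 Thm 4.1 proof: the bit-graph `μ` of the
  `2^{poly}`-step locally checkable computation of a machine for `A` and the first-divergence pointer `σ̂`
  are in `EXP`, hence 3-tt-reduce to `A`; round 1 computes the two candidate verdicts `d₀, d₁` and the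
  pointer `i`, round 2 checks local consistency at `i`). Size XL in this tree (tableau bit-graph in `EXP`,
  cf. `Tableau.rowLang_mem_EXP`; `FP` plumbing of `TruthTableClosure.lean`). Believed TRUE unconditionally
  and it RELATIVIZES (archive certificate: the 2-round theorem holds relative to every oracle) — so it is
  NOT summit-strength and does not give the crux (probe below).
* `stub_secondRoundRemovalOnTallies` — THE KERNEL (open; the hardest stub): for a `≤ᵖ_{3-tt}`-hard `A ∈ EXP`
  GIVEN a self-avoiding two-round autoreduction, produce a one-round self-avoiding scheme correct on the
  tallies `0ⁿ` of ALL BUT FINITELY MANY lengths (`∃ N, ∀ n ≥ N`). HONEST FLAG (BC3 (c), recorded in the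
  seat's NOTES.md and in `Lines/birth.md`): with `stub_twoRound` a theorem, the kernel is EQUIVALENT to the
  crux (crux ⇒ kernel trivially; kernel + thm B + the patch below ⇒ crux), hence summit-strength
  mathematically — intrinsic to this crux (see above), not an artefact of the cut; the mechanical probes FAIL
  as required (no landed theorem has either shape). What the cut buys: the kernel prover is handed a
  CONCRETE OBJECT — the second round, which by thm B's proof depends on the round-1 answers only through a
  `poly(n)`-bit pointer and consists of `O(1)` runs of one fixed 3-query reduction — and must remove it
  only at ONE input per length, asymptotically. It is exactly the non-relativizing residue: relative to the
  archive's oracle `W = pad(A₀)` some 3-tt-complete set is 2-round-, 1-advice-bit- and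
  errorless-off-tally-autoreducible but NOT tt-autoreducible (fails on the tallies), so no relativizing
  argument proves the kernel ("why it might fail" of the crux, verbatim the route header).
* the SEAM (sorry-free, proved here): `tallyScheme_of_eventually` — FINITE PATCHING: a scheme correct on the
  tallies of lengths `≥ N` is made correct on all tallies by the evaluator
  `D' = (D ⊓ {w : N ≤ |fst w|}) ⊔ fst⁻¹{x ∈ A : |x| < N}` (`∈ P`: `LenLt_mem_P`, `preimage_mem_P`,
  `inter_mem_P`, `union_mem_P`, finite languages are in `P`), same queries, same self-avoidance; and
  `tallyAutoreducible_of_sigs` — the composition with explicit hypotheses whose conclusion is the crux BODY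
  verbatim (so that `TallyAutoreducible_of` is the file's ONLY theorem headed by the crux name, what
  `ledger skeleton check` keys on).
* `TallyAutoreducible_of : TallyAutoreducible` — THE skeleton theorem: the crux BY NAME from the two
  declared stubs (the only `sorry`s of the file).

Design alternatives considered and NOT registered (seat NOTES.md §Design): (a) the route header's foreseen
split `OneBitAdvice → AdviceRemovalOnTally` — `OneBitAdvice` (every 3-tt-hard set for EXP is
tt-autoreducible with one advice bit per length; archive Cor. onebitH: true under `H_IW` or `P = NP`) is
itself OPEN unconditionally (an `H_IW`-grade derandomisation: find deterministically an element of a dense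
`P`-recognisable set of directions), so that line would carry TWO independent open stubs; it is recorded in
`Lines/birth.md` as a conditional hypothesis a kernel prover may add. (b) ROBUSTNESS AGAINST `0*` (archive
Cor. robust (a); Buhrman–Torenvliet 2005 §3 "forbidden queries"): `A ∖ 0*` still `≤tt`-hard ⇒ the crux by
`P`-plumbing — strictly STRONGER than the crux with weaker evidence (not implied even by full
tt-autoreducibility). (c) errorless density-`(1 − 1/poly)` autoreductions (archive thm:density,
unconditional) — no purchase on ONE string per length.

Disproof used: none exists for this crux (`ledger crux ls stmt-PneNP-15947`: no workfiles, no
Disproof.lean, no crux ideas, 2026-08-17). Negatives honoured: `ledger negatives --problem PneNP` (5 refuted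
statements: Lyapunov/PHP, Bavard planted genus, Circuit magnification frontier, OR-incompressibility/TC⁰,
TwoTones) — none concerns autoreducibility, truth-table reductions or `EXP`-complete sets; neither stub is
an instance of a refuted statement. Typing checklist 4c: no thresholds hand-picked (`∃ N`, polynomials
free), no integrals, no gauge.

BC3 audit (`lean check --json` of this file, 2026-08-17): rc 0, errors [], sorries 2 = the two stubs
(`stub_twoRound`, `stub_secondRoundRemovalOnTallies`), zero elsewhere — H21 file audit:
`tallyScheme_of_eventually` closed=true, `tallyAutoreducible_of_sigs` closed=true, `TallyAutoreducible_of`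
proof-of-item "NOT closed: axioms [sorryAx]" (from the stubs only). BC3 probes (seat folder
`bc/probe_twoRound.lean`, `bc/probe_kernel.lean`, `bc/probe_supplementary.lean`, `maxHeartbeats 400000`):
for each stub `S` (statement wrapped in a local `def`), `S → TallyAutoreducible` and `S → PneNP` by
`first | exact? | simpa | aesop` FAIL — 4/4 mandatory probes rc 1 ("unsolved goals ⊢ TallyAutoreducible" /
"⊢ PneNP", aesop: failed after exhaustive search); the unfolded variants (`simpa [S, C]`,
`unfold S C; simpa | aesop | exact?`) FAIL too (assumption failed / aesop max recursion / `exact?` could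
not close the goal) — 8/8; converse probes `TallyAutoreducible → S`, `PneNP → S` also fail for both stubs
by the same tactics (recorded; mathematically the crux DOES imply the kernel with `N = 0` — the expected
consequence direction, used toward the crux together with `stub_twoRound` — and nothing known gives
`stub_twoRound` short of proving it).

References: H. Buhrman, L. Fortnow, D. van Melkebeek, L. Torenvliet, *Separating complexity classes using
autoreducibility*, SIAM J. Comput. 29 (2000) 1497–1520, Thm 4.1, Lemma 3.5, Fig. 7 q.4 [BuhrmanEtAl2000];
H. Buhrman, L. Torenvliet, *A Post's program for complexity theory*, Bull. EATCS 85 (2005) 41–51, §3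
[BuhrmanTorenvliet2005]; C. Glaßer, M. Ogihara, A. Pavan, A. Selman, L. Zhang, *Autoreducibility,
mitoticity, and immunity*, JCSS 73 (2007) [GlaerEtAl2007]; the 2001 programme's route
exp-truth-table-autoreducibility, paper v7 (8695a0cc) Thm B, Cor. sandwich, Prop. onebit, Thm sparsett,
Cor. onebitH, Cor. robust (run/shared/lean/archive/2001/…/paper/paper.tex; adapt, never copy).
Planner planner-skel-stmt-PneNP-15947-0, 2026-08-17.
-/

set_option linter.dupNamespace false
set_option linter.unusedVariables false

namespace Summit.PneNP.PneNP.Cruxes.TallyAutoreducible.Birth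

open Literature.Computability.Complexity
open Summit.PneNP.PneNP.Theses.Autoreducibility

/-! ## The two registered stubs -/

/-- **Stub 1 — TWO ROUNDS OF NONADAPTIVE QUERIES ALWAYS SUFFICE (archive Theorem B = BFvMT Thm 4.1 with
rounds book-kept; KNOWN, size XL).** Every `A ∈ EXP` that is `≤ᵖ_{3-tt}`-hard for `EXP` has a self-avoiding
TWO-ROUND polynomial-time nonadaptive autoreduction, typed by nesting the tree's `ttLang`: round 1 asks
`Q₁⟨x,1ⁱ⟩ ≠ x` (`i < q₁(|x|)`) and hands `⟨x, answers⟩` to the tt-reduction `ttLang Q₂ q₂ D₂ A`, whose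
queries `Q₂⟨⟨x,a⟩,1ⁱ⟩ ≠ x` (`i < q₂(|⟨x,a⟩|)`, for EVERY answer string `a`) are round 2; correctness on all
inputs is the set equation. Proof in print: the bit-graph `μ` of the locally checkable `2^{p(n)}`-step
computation of a machine accepting `A`, and the bit-graph `σ̂` of the first position where the two
candidate computations (`x` answered `0` / `1`) diverge, are in `EXP`, so 3-tt-reduce to `A`; round 1
evaluates both candidate verdicts and the pointer, round 2 checks local consistency at the pointer with
`c_M + 1` further runs of the `μ`-reduction. Relativizes; consistent with `P = NP`; not summit-strength.
[cite: BuhrmanEtAl2000, Thm 4.1 (proof), Def. 2.1] [cite: BuhrmanTorenvliet2005, §3]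
(2001 archive route exp-truth-table-autoreducibility, paper v7 Thm B — adapt, never copy.) -/
theorem stub_twoRound :
    ∀ A ∈ Literature.Computability.Complexity.EXP,
      Literature.Computability.Complexity.IsBddTTHard 3 Literature.Computability.Complexity.EXP A →
        ∃ Q₁ ∈ Literature.Computability.Complexity.FP, ∃ q₁ : Polynomial ℕ,
        ∃ Q₂ ∈ Literature.Computability.Complexity.FP, ∃ q₂ : Polynomial ℕ,
        ∃ D₂ ∈ Literature.Computability.Complexity.Classes.P,
          (∀ x : List Bool, ∀ i < q₁.eval x.length,
              Q₁ (Literature.Computability.Complexity.boolPair x (List.replicate i true)) ≠ x) ∧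
          (∀ x a : List Bool,
              ∀ i < q₂.eval (Literature.Computability.Complexity.boolPair x a).length,
                Q₂ (Literature.Computability.Complexity.boolPair
                  (Literature.Computability.Complexity.boolPair x a) (List.replicate i true)) ≠ x) ∧
          A = Literature.Computability.Complexity.ttLang Q₁ q₁
                (Literature.Computability.Complexity.ttLang Q₂ q₂ D₂ A) A := by
  sorry

/-- **Stub 2 — THE KERNEL: REMOVING THE SECOND ROUND ON TALLY INPUTS, EVENTUALLY (open; hardest stub;
summit-strength — flagged in the module docstring).** For `A ∈ EXP` `≤ᵖ_{3-tt}`-hard for `EXP`, GIVEN a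
self-avoiding two-round nonadaptive autoreduction of `A` (the conclusion of `stub_twoRound`, verbatim),
there is a ONE-round self-avoiding polynomial-time scheme `(Q, q, D)` and a threshold `N` such that for all
`n ≥ N`, `0ⁿ ∈ A ↔ 0ⁿ ∈ ttLang Q q D A`. Why plausibly true: it is implied by BFvMT's question 4 (indeed by
`PH = EXP`, archive Cor. sandwich (b)), and by the crux; the two-round scheme handed over depends on its
round-1 answers only through a `poly(n)`-bit pointer (thm B's proof), only ONE input per length has to be
served, and only asymptotically. Why it might fail: under `P = NP` it is false (archive Thm A(i) +
Prop. onebit: the BFvMT Lemma 3.5 diagonal set is 2-round- but not tally-autoreducible), and it fails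
relative to the archive's oracle `W` — any proof is non-relativizing. [cite: BuhrmanEtAl2000, Fig. 7 q.4,
Lemma 3.5, Thm 4.1] [cite: BuhrmanTorenvliet2005, §3] [cite: GlaerEtAl2007]
(2001 archive paper v7 Cor. sandwich (c), Prop. onebit, §"Why one round resists".) -/
theorem stub_secondRoundRemovalOnTallies :
    ∀ A ∈ Literature.Computability.Complexity.EXP,
      Literature.Computability.Complexity.IsBddTTHard 3 Literature.Computability.Complexity.EXP A →
        (∃ Q₁ ∈ Literature.Computability.Complexity.FP, ∃ q₁ : Polynomial ℕ,
          ∃ Q₂ ∈ Literature.Computability.Complexity.FP, ∃ q₂ : Polynomial ℕ,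
          ∃ D₂ ∈ Literature.Computability.Complexity.Classes.P,
            (∀ x : List Bool, ∀ i < q₁.eval x.length,
                Q₁ (Literature.Computability.Complexity.boolPair x (List.replicate i true)) ≠ x) ∧
            (∀ x a : List Bool,
                ∀ i < q₂.eval (Literature.Computability.Complexity.boolPair x a).length,
                  Q₂ (Literature.Computability.Complexity.boolPair
                    (Literature.Computability.Complexity.boolPair x a) (List.replicate i true)) ≠ x) ∧
            A = Literature.Computability.Complexity.ttLang Q₁ q₁
                  (Literature.Computability.Complexity.ttLang Q₂ q₂ D₂ A) A) →
        ∃ Q ∈ Literature.Computability.Complexity.FP, ∃ q : Polynomial ℕ,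
        ∃ D ∈ Literature.Computability.Complexity.Classes.P, ∃ N : ℕ,
          (∀ x : List Bool, ∀ i < q.eval x.length,
              Q (Literature.Computability.Complexity.boolPair x (List.replicate i true)) ≠ x) ∧
          ∀ n ≥ N, (List.replicate n false ∈ A ↔
            List.replicate n false ∈ Literature.Computability.Complexity.ttLang Q q D A) := by
  sorry

/-! ## The seam (sorry-free): finite patching and the composition -/

private theorem memL_sup {L₁ L₂ : Language Bool} {w : List Bool} : w ∈ L₁ ⊔ L₂ ↔ w ∈ L₁ ∨ w ∈ L₂ :=
  Iff.rfl

private theorem memL_inf {L₁ L₂ : Language Bool} {w : List Bool} : w ∈ L₁ ⊓ L₂ ↔ w ∈ L₁ ∧ w ∈ L₂ :=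
  Iff.rfl

private theorem memL_compl {L : Language Bool} {w : List Bool} : w ∈ Lᶜ ↔ w ∉ L := Iff.rfl

private theorem memL_setOf {p : List Bool → Prop} {w : List Bool} :
    @Membership.mem (List Bool) (Language Bool) _ {v | p v} w ↔ p w := Iff.rfl

/-- **Finite patching of a tally-correct scheme (seam, proved).** If a self-avoiding nonadaptive scheme
`(Q, q, D)` decides `0ⁿ ∈ A` correctly for all `n ≥ N`, then the scheme with the SAME queries and the
patched evaluator `D' = (D ⊓ {w | ¬ |fst w| < N}) ⊔ fst⁻¹{x ∈ A | |x| < N}` — still in `P`: the length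
test is `⟨ε, fst w⟩ ∈ LenLt (C N)` (`LenLt_mem_P`, `pairFn`/`fstP ∈ FP`, `preimage_mem_P`, closure of `P`
under `ᶜ, ⊓, ⊔`), and the table `{x ∈ A | |x| < N}` is a finite language (`mem_P_of_finite`) — is correct
on EVERY tally input; self-avoidance is untouched (finite patching by table lookup). [folklore] -/
theorem tallyScheme_of_eventually {A : Language Bool} {Q : List Bool → List Bool} {q : Polynomial ℕ}
    {D : Language Bool} {N : ℕ} (hQ : Q ∈ FP) (hD : D ∈ Classes.P)
    (hsa : ∀ x : List Bool, ∀ i < q.eval x.length, Q (boolPair x (List.replicate i true)) ≠ x)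
    (hN : ∀ n ≥ N, (List.replicate n false ∈ A ↔ List.replicate n false ∈ ttLang Q q D A)) :
    ∃ Q' ∈ FP, ∃ q' : Polynomial ℕ, ∃ D' ∈ Classes.P,
      (∀ x : List Bool, ∀ i < q'.eval x.length, Q' (boolPair x (List.replicate i true)) ≠ x) ∧
      ∀ n : ℕ, (List.replicate n false ∈ A ↔ List.replicate n false ∈ ttLang Q' q' D' A) := by
  classical
  -- `Short w ↔ |fst w| < N`, `Table w ↔ fst w ∈ A ∧ |fst w| < N`
  let Short : Language Bool := pairFn (fun _ => ([] : List Bool)) fstP ⁻¹' LenLt (Polynomial.C N)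
  let Table : Language Bool := fstP ⁻¹' ({x | x ∈ A ∧ x.length < N} : Language Bool)
  have hShort : Short ∈ Classes.P :=
    preimage_mem_P (LenLt_mem_P _) (pairFn_mem_FP (const_mem_FP _) fstP_mem_FP)
  have hfin : (({x | x ∈ A ∧ x.length < N} : Language Bool) : Set (List Bool)).Finite :=
    (List.finite_length_lt Bool N).subset fun x hx => hx.2
  have hTable : Table ∈ Classes.P :=
    preimage_mem_P (Literature.Barriers.PneNP.mem_P_of_finite hfin) fstP_mem_FP
  have hD' : (D ⊓ Shortᶜ) ⊔ Table ∈ Classes.P :=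
    union_mem_P (inter_mem_P hD (compl_mem_P_iff.2 hShort)) hTable
  refine ⟨Q, hQ, q, (D ⊓ Shortᶜ) ⊔ Table, hD', hsa, fun n => ?_⟩
  -- membership of a pair `⟨0ⁿ, bits⟩` in the patched evaluator
  have hmem : ∀ bits : List Bool,
      boolPair (List.replicate n false) bits ∈ (D ⊓ Shortᶜ) ⊔ Table ↔
        (boolPair (List.replicate n false) bits ∈ D ∧ ¬ n < N) ∨
          (List.replicate n false ∈ A ∧ n < N) := by
    intro bits
    rw [memL_sup, memL_inf, memL_compl]
    simp only [Short, Table, memL_preimage, pairFn_apply, fstP_boolPair, boolPair_mem_LenLt,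
      Polynomial.eval_C, List.length_replicate, memL_setOf]
  rw [mem_ttLang_iff, hmem]
  by_cases hn : n < N
  · simp only [hn, not_true_eq_false, and_false, false_or, and_true]
  · have h := hN n (Nat.le_of_not_lt hn)
    rw [mem_ttLang_iff] at h
    simp only [hn, not_false_eq_true, and_true, and_false, or_false]
    exact h

/-- **Composition with explicit hypotheses** (BC3 shape `two-round → kernel → crux`; the conclusion is the
crux's BODY verbatim, the hypotheses are the two stub statements verbatim). For a `≤ᵖ_{3-tt}`-hard
`A ∈ EXP`: thm B gives the two-round autoreduction, the kernel turns it into a one-round scheme correct on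
the tallies of lengths `≥ N`, and `tallyScheme_of_eventually` patches the finitely many short lengths.
[folklore] -/
theorem tallyAutoreducible_of_sigs
    (hB : ∀ A ∈ Literature.Computability.Complexity.EXP,
      Literature.Computability.Complexity.IsBddTTHard 3 Literature.Computability.Complexity.EXP A →
        ∃ Q₁ ∈ Literature.Computability.Complexity.FP, ∃ q₁ : Polynomial ℕ,
        ∃ Q₂ ∈ Literature.Computability.Complexity.FP, ∃ q₂ : Polynomial ℕ,
        ∃ D₂ ∈ Literature.Computability.Complexity.Classes.P,
          (∀ x : List Bool, ∀ i < q₁.eval x.length,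
              Q₁ (Literature.Computability.Complexity.boolPair x (List.replicate i true)) ≠ x) ∧
          (∀ x a : List Bool,
              ∀ i < q₂.eval (Literature.Computability.Complexity.boolPair x a).length,
                Q₂ (Literature.Computability.Complexity.boolPair
                  (Literature.Computability.Complexity.boolPair x a) (List.replicate i true)) ≠ x) ∧
          A = Literature.Computability.Complexity.ttLang Q₁ q₁
                (Literature.Computability.Complexity.ttLang Q₂ q₂ D₂ A) A)
    (hK : ∀ A ∈ Literature.Computability.Complexity.EXP,
      Literature.Computability.Complexity.IsBddTTHard 3 Literature.Computability.Complexity.EXP A →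
        (∃ Q₁ ∈ Literature.Computability.Complexity.FP, ∃ q₁ : Polynomial ℕ,
          ∃ Q₂ ∈ Literature.Computability.Complexity.FP, ∃ q₂ : Polynomial ℕ,
          ∃ D₂ ∈ Literature.Computability.Complexity.Classes.P,
            (∀ x : List Bool, ∀ i < q₁.eval x.length,
                Q₁ (Literature.Computability.Complexity.boolPair x (List.replicate i true)) ≠ x) ∧
            (∀ x a : List Bool,
                ∀ i < q₂.eval (Literature.Computability.Complexity.boolPair x a).length,
                  Q₂ (Literature.Computability.Complexity.boolPair
                    (Literature.Computability.Complexity.boolPair x a) (List.replicate i true)) ≠ x) ∧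
            A = Literature.Computability.Complexity.ttLang Q₁ q₁
                  (Literature.Computability.Complexity.ttLang Q₂ q₂ D₂ A) A) →
        ∃ Q ∈ Literature.Computability.Complexity.FP, ∃ q : Polynomial ℕ,
        ∃ D ∈ Literature.Computability.Complexity.Classes.P, ∃ N : ℕ,
          (∀ x : List Bool, ∀ i < q.eval x.length,
              Q (Literature.Computability.Complexity.boolPair x (List.replicate i true)) ≠ x) ∧
          ∀ n ≥ N, (List.replicate n false ∈ A ↔
            List.replicate n false ∈ Literature.Computability.Complexity.ttLang Q q D A)) :
    ∀ A ∈ Literature.Computability.Complexity.EXP,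
      (∀ K ∈ Literature.Computability.Complexity.EXP, ∃ Q ∈ Literature.Computability.Complexity.FP,
        ∃ D ∈ Literature.Computability.Complexity.Classes.P,
          K = Literature.Computability.Complexity.ttLang Q (Polynomial.C 3) D A) →
      ∃ Q ∈ Literature.Computability.Complexity.FP, ∃ q : Polynomial ℕ,
      ∃ D ∈ Literature.Computability.Complexity.Classes.P,
        (∀ x : List Bool, ∀ i < q.eval x.length,
            Q (Literature.Computability.Complexity.boolPair x (List.replicate i true)) ≠ x) ∧
        ∀ n : ℕ, (List.replicate n false ∈ A ↔
          List.replicate n false ∈ Literature.Computability.Complexity.ttLang Q q D A) := by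
  intro A hA hH
  -- the inlined hardness hypothesis IS `IsBddTTHard 3 EXP A` (`isBddTTHard_iff` is `Iff.rfl`)
  have hH' : IsBddTTHard 3 EXP A := hH
  obtain ⟨Q, hQ, q, D, hD, N, hsa, hN⟩ := hK A hA hH' (hB A hA hH')
  exact tallyScheme_of_eventually hQ hD hsa hN

/-! ## The skeleton theorem -/

/-- **THE SKELETON THEOREM.** The crux `Summit.PneNP.PneNP.Theses.Autoreducibility.TallyAutoreducible`,
concluded BY NAME from the two DECLARED stubs `stub_twoRound` and `stub_secondRoundRemovalOnTallies` (the
only `sorry`s of the file) through the sorry-free composition `tallyAutoreducible_of_sigs`. Once both stubs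
land, this term (stub names replaced by the landed theorems) is the proof to propose with
`--workitem stmt-PneNP-15947`. [folklore] -/
theorem TallyAutoreducible_of : Summit.PneNP.PneNP.Theses.Autoreducibility.TallyAutoreducible :=
  tallyAutoreducible_of_sigs stub_twoRound stub_secondRoundRemovalOnTallies

end Summit.PneNP.PneNP.Cruxes.TallyAutoreducible.Birth
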